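/- Copyright: the b2b-balaban cell (near-miss cell 7), T⁴-continuum fan-out, NE7b swarm leaf 07 (gen 5; road W-RP, sub-row
«W3n», file 3: CUBE COLUMNS — the column σ-algebra of a cube cell, `loc`∕`sym` at the cube cuts, the `EventSide`
producers for cube-column events).  Released under the licence of the surrounding project. -/
import Summits.QuantumFields.BalabanUV.T4Continuum.Support.HistoryRPTowerColumnSigma
import Summits.QuantumFields.BalabanUV.T4Continuum.Support.HistoryChessboardEventsCubeSites

/-!
# History chessboard road: CUBE COLUMNS — the column σ-algebra of a cube cell, `loc` and `sym` at the cube cuts (W3n, file 3)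

Summits-side support leaf of the T⁴-continuum cell (rung (B)+1 on a FINITE torus only; NOT infinite volume, NOT the
mass gap, NOT the Clay statement; NOT a proof of the spine estimate NE7b).  Road W-RP (R-OWNER-23-2 ∕ R-OWNER-23-8) of
the swarm claim table `t4/b2b-balaban-t4-ne7b-p1/LEAVES-NE7b.md`, sub-row «W3n» (leaf-07 g5; INTENT journal l.17184,
«MINE» l.17238), file 3: the JUNCTION, by name, of
* W3n file 2 (`HistoryRPTowerColumnSigma`, leaf-07 g5): the column σ-algebra `colAlg G K S` of a set `S` of top sites,
  `colAlg_le_cutPos` (`loc` supplier), `measurable_cutRefl_colAlg` (`sym` geometry), `colAlg_le`,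
  `measurable_eval_linkAlg`∕`measurable_last_colAlg`∕`measurable_fst_colAlg`;
* W4 file 4c∕4d (`HistoryChessboardEventsCubes`∕`…CubeSites`, leaf-06 g6): the tower-law reading on the block torus of
  CUBES of side `M` of the top lattice (`h : P.sitesPerDir K = M · N`; `cubeCut`, `cubePos`, `cubeRefl`), the cube of a
  top site `cubeOf M N y`, the top sites of a cube `cubeSites M c`, and the two geometric letters
  `cubeSites_subset_slab` (a positive-half cube lies in the slab of its cut) and `image_sref_cubeSites` (the site
  reflection at the cube cut carries the sites of `c` onto the sites of `cellReflect i k c`).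
[folklore] σ-algebra bookkeeping; no definition, no `structure`, no `[cite:]` tag, no `Prop`-valued definition (c1), no
constant (c2∕c6), no exit ∕ socket ∕ `HistoryConstants` file (c3); nothing printed asserted.

WHY.  With cells the single top sites (file 4b) a cell event reads no bond of the top field; file 4c re-indexes the
reading by cubes, and the natural event algebra of the cube cell `c` is the COLUMN ALGEBRA OF ITS TOP SITES,
`colAlg G K (cubeSites M c)`: the variables of the top links INSIDE the cube and of every link inside the columns below
it.  For such CUBE-COLUMN events W4b′'s `loc` is a theorem and `sym` reduces to one template sentence.

WHAT.
* §1 `loc` AT THE CUBE CUTS: **`colAlg_cubeSites_le_cubePos`** (`K ≤ m + K_P`, `c ∈ halfPlus N i k` ⇒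
  `colAlg G K (cubeSites M c) ≤ cubePos G h i k`), **`measurableSet_cubePos_of_colAlg`**.
* §2 `sym` AT THE CUBE CUTS: **`measurable_cubeRefl_colAlg`** (`Measurable[colAlg G K (cubeSites M (cellReflect i k c)),
  colAlg G K (cubeSites M c)] (cubeRefl h i k)`), **`measurableSet_preimage_cubeRefl_of_colAlg`**.
* §3 THE `EventSide` PRODUCERS for a cube-column event model `E : Λ → BlockIdx P.d N → Set (Tower P G K)`,
  `hcol : ∀ l ∈ Pat, ∀ c, MeasurableSet[colAlg G K (cubeSites M c)] (E l c)` — in file 4a's binder shapes at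
  `Ω := Tower P G K`, `mP := cubePos G h`, `θ := cubeRefl h`: **`E_meas_of_cubeColumn`** (`∀ l ∈ Pat, ∀ c,
  MeasurableSet (E l c)`), **`loc_of_cubeColumn`** (`∀ l ∈ Pat, ∀ i k, ∀ c ∈ halfPlus N i k, MeasurableSet[cubePos G h i k]
  (E l c)`), and `sym_of_template` (the (R-sym) TEMPLATE SENTENCE `∀ l ∈ Pat, ∀ i k c, E l (cellReflect i k c) =
  cubeRefl h i k ⁻¹' E l c` IS the field `sym`, up to `Eq.symm` — recorded so the census names the one displayed
  sentence; `preimage_mem_cubeColumn` says its right member is a cube-column event of the reflected cube).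
* §4 USE PATTERN: a TOP link with both endpoints in the cube, and a level-`K` link under a cube of a height-`K+1` tower,
  are cube-column coordinates (`measurable_last_cube_link`, `example`).

HONEST SCOPE.  A junction by name.  Displayed on road W for an instantiating seat: WHICH events model Bałaban's terms and
that they are cube-column events ((EXT): `repr`∕`ev_cover`∕`bad_disj`∕`bad_sub` of file 4a's `EventSide`), the (R-sym)
template sentence, (U1)∕(G2) (`univ_le`); the typing identification «`blockAvg ℰ` is (0.4)» T-class.  Nothing of H3 ∕
(B) ∕ BetaPertH; NE7b NOT proved; spine 0∕9.  HONEST DEPENDENCY (cell): continuum YM on T⁴ ⇐ BetaPertH ∧ nine spine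
estimates (0/9 proved); BetaPertH ⇐ (D1) ∧ (D4) ∧ CAP+tail; G-an2-4 gates asym, D1 and NE2/3/4.  This file changes none
of it. -/

open MeasureTheory
open Literature.Barriers.CriticalPhenomena.NonGibbs
open Literature.MathematicalPhysics.QuantumFieldTheory
open Literature.MathematicalPhysics.QuantumFieldTheory.Balaban1983to89
open Summit.QuantumFields.BalabanUV.T4Continuum.HistoryRPTowerLaw
open Summit.QuantumFields.BalabanUV.T4Continuum.HistoryRPTowerCuts
open Summit.QuantumFields.BalabanUV.T4Continuum.HistoryRPTowerColumns
open Summit.QuantumFields.BalabanUV.T4Continuum.HistoryRPTowerColumnSigma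
open Summit.QuantumFields.BalabanUV.T4Continuum.HistoryChessboardEventsCubes
open Summit.QuantumFields.BalabanUV.T4Continuum.HistoryChessboardEventsCubeSites

namespace Summit.QuantumFields.BalabanUV.T4Continuum.HistoryRPTowerColumnCubes

noncomputable section

variable {P : Params} {G : Type*} {M N K : ℕ}

/-! ## §1 `loc` at the cube cuts -/

section Loc

variable (G) [MeasurableSpace G] [NeZero N]

/-- **THE COLUMN ALGEBRA OF A POSITIVE-HALF CUBE IS BELOW THE CUBE CUT'S POSITIVE ALGEBRA** (`K ≤ m + K_P`): W3n-2's
`colAlg_le_cutPos` at the cube cut over file 4d's `cubeSites_subset_slab`. [folklore] -/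
theorem colAlg_cubeSites_le_cubePos (hK : K ≤ P.m + P.K) (h : P.sitesPerDir K = M * N) {i : Fin P.d} {k : ZMod N}
    {c : BlockIdx P.d N} (hc : c ∈ halfPlus N i k) : colAlg G K (cubeSites (K := K) M c) ≤ cubePos G h i k :=
  colAlg_le_cutPos G K hK i (cubeCut h k) (cubeSites M c) (cubeSites_subset_slab h hc)

/-- **`loc` ON THE CUBE TORUS, IN W4b′'s LETTERS**: a cube-column event of a positive-half cube is a positive-half event
of the cube cut. [folklore] -/
theorem measurableSet_cubePos_of_colAlg (hK : K ≤ P.m + P.K) (h : P.sitesPerDir K = M * N) {i : Fin P.d} {k : ZMod N}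
    {c : BlockIdx P.d N} (hc : c ∈ halfPlus N i k) {E : Set (Tower P G K)}
    (hE : MeasurableSet[colAlg G K (cubeSites (K := K) M c)] E) : MeasurableSet[cubePos G h i k] E :=
  colAlg_cubeSites_le_cubePos G hK h hc E hE

end Loc

/-! ## §2 `sym` at the cube cuts -/

section Sym

variable (G) [GaugeGroup G] [MeasurableSpace G] [MeasurableInv G] [NeZero N]

/-- **THE CUBE REFLECTION READS THE COLUMN ALGEBRA OF A CUBE FROM THE COLUMN ALGEBRA OF THE REFLECTED CUBE**
(`K ≤ m + K_P`): W3n-2's `measurable_cutRefl_colAlg` at the cube cut, re-indexed by file 4d's `image_sref_cubeSites`.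
[folklore] -/
theorem measurable_cubeRefl_colAlg (hK : K ≤ P.m + P.K) (h : P.sitesPerDir K = M * N) (i : Fin P.d) (k : ZMod N)
    (c : BlockIdx P.d N) :
    Measurable[colAlg G K (cubeSites (K := K) M (cellReflect i k c)), colAlg G K (cubeSites (K := K) M c)]
      (cubeRefl (G := G) h i k) := by
  rw [cubeRefl_eq, ← image_sref_cubeSites h i k c]
  exact measurable_cutRefl_colAlg G K hK i (cubeCut h k) (cubeSites M c)

/-- **`sym` ON THE CUBE TORUS, GEOMETRIC HALF, IN W4b′'s LETTERS**: the preimage under the cube reflection of a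
cube-column event of `c` is a cube-column event of `cellReflect i k c`. [folklore] -/
theorem measurableSet_preimage_cubeRefl_of_colAlg (hK : K ≤ P.m + P.K) (h : P.sitesPerDir K = M * N) (i : Fin P.d)
    (k : ZMod N) (c : BlockIdx P.d N) {E : Set (Tower P G K)}
    (hE : MeasurableSet[colAlg G K (cubeSites (K := K) M c)] E) :
    MeasurableSet[colAlg G K (cubeSites (K := K) M (cellReflect i k c))] (cubeRefl (G := G) h i k ⁻¹' E) :=
  measurable_cubeRefl_colAlg G hK h i k c hE

end Sym

/-! ## §3 The `EventSide` producers for a cube-column event model -/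

section Producers

variable (G) {Λ : Type*} {Pat : Finset Λ}

/-- **`E_meas` FOR CUBE-COLUMN EVENTS** (file 4a's binder shape): column algebras are sub-σ-algebras of the carrier's.
[folklore] -/
theorem E_meas_of_cubeColumn [MeasurableSpace G] {E : Λ → BlockIdx P.d N → Set (Tower P G K)}
    (hcol : ∀ l ∈ Pat, ∀ c, MeasurableSet[colAlg G K (cubeSites (K := K) M c)] (E l c)) :
    ∀ l ∈ Pat, ∀ c : BlockIdx P.d N, MeasurableSet (E l c) :=
  fun l hl c => colAlg_le G K (cubeSites M c) _ (hcol l hl c)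

/-- **`loc` FOR CUBE-COLUMN EVENTS** (file 4a's binder shape at `mP := cubePos G h`; `K ≤ m + K_P`). [folklore] -/
theorem loc_of_cubeColumn [MeasurableSpace G] [NeZero N] {E : Λ → BlockIdx P.d N → Set (Tower P G K)}
    (hK : K ≤ P.m + P.K) (h : P.sitesPerDir K = M * N)
    (hcol : ∀ l ∈ Pat, ∀ c, MeasurableSet[colAlg G K (cubeSites (K := K) M c)] (E l c)) :
    ∀ l ∈ Pat, ∀ (i : Fin P.d) (k : ZMod N), ∀ c ∈ halfPlus N i k, MeasurableSet[cubePos G h i k] (E l c) :=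
  fun l hl _ _ c hc => measurableSet_cubePos_of_colAlg G hK h hc (hcol l hl c)

/-- **`sym` IS THE TEMPLATE SENTENCE** (file 4a's binder shape at `θ := cubeRefl h`): the (R-sym) reading «the event of
the reflected cube is the reflected event», displayed by the instantiating seat, is the field up to `Eq.symm`.
[folklore] -/
theorem sym_of_template [GaugeGroup G] {E : Λ → BlockIdx P.d N → Set (Tower P G K)}
    (h : P.sitesPerDir K = M * N)
    (hsym : ∀ l ∈ Pat, ∀ (i : Fin P.d) (k : ZMod N) (c : BlockIdx P.d N),
      E l (cellReflect i k c) = cubeRefl (G := G) h i k ⁻¹' E l c) :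
    ∀ l ∈ Pat, ∀ (i : Fin P.d) (k : ZMod N) (c : BlockIdx P.d N),
      cubeRefl (G := G) h i k ⁻¹' E l c = E l (cellReflect i k c) :=
  fun l hl i k c => (hsym l hl i k c).symm

/-- … and its right member is where it should be: the reflected event of a cube-column event of `c` is a cube-column
event of the reflected cube (§2), so the template sentence is CONSISTENT with `hcol` (`K ≤ m + K_P`). [folklore] -/
theorem preimage_mem_cubeColumn [GaugeGroup G] [MeasurableSpace G] [MeasurableInv G] [NeZero N]
    {E : Λ → BlockIdx P.d N → Set (Tower P G K)} (hK : K ≤ P.m + P.K) (h : P.sitesPerDir K = M * N)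
    (hcol : ∀ l ∈ Pat, ∀ c, MeasurableSet[colAlg G K (cubeSites (K := K) M c)] (E l c)) :
    ∀ l ∈ Pat, ∀ (i : Fin P.d) (k : ZMod N) (c : BlockIdx P.d N),
      MeasurableSet[colAlg G K (cubeSites (K := K) M (cellReflect i k c))] (cubeRefl (G := G) h i k ⁻¹' E l c) :=
  fun l hl i k c => measurableSet_preimage_cubeRefl_of_colAlg G hK h i k c (hcol l hl c)

end Producers

/-! ## §4 Use pattern: top links inside a cube, links under a cube, are cube-column coordinates -/

section Sanity

variable (G) [MeasurableSpace G]

/-- **A TOP-LEVEL LINK WITH BOTH ENDPOINTS IN THE CUBE `c` IS A CUBE-COLUMN COORDINATE** (the variables file 4c's cube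
events may read at the top level — none for single-site cells). [folklore] -/
theorem measurable_last_cube_link {c : BlockIdx P.d N} {b : PBond P K} (hs : cubeOf M N b.src = c)
    (ht : cubeOf M N b.tgt = c) :
    Measurable[colAlg G K (cubeSites (K := K) M c)] fun ω : Tower P G K => last K ω b := by
  have hb : b ∈ links (cubeSites (K := K) M c) := by
    rw [mem_links, mem_cubeSites, mem_cubeSites]
    exact ⟨hs, ht⟩
  exact (measurable_eval_linkAlg G hb).comp (measurable_last_colAlg G K _)

/-- … and a link one level down whose endpoints' blocks lie in the cube (height `K + 1`, level `K`). [folklore] -/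
example {c : BlockIdx P.d N} (b : PBond P K) (hs : cubeOf M N (blockOf b.src) = c)
    (ht : cubeOf M N (blockOf b.tgt) = c) :
    Measurable[colAlg G (K + 1) (cubeSites (K := K + 1) M c)] fun ω : Tower P G (K + 1) => last K ω.1 b := by
  have hb : b ∈ links (under (cubeSites (K := K + 1) M c)) := by
    rw [mem_links, mem_under, mem_under, mem_cubeSites, mem_cubeSites]
    exact ⟨hs, ht⟩
  exact ((measurable_eval_linkAlg G hb).comp (measurable_last_colAlg G K _)).comp (measurable_fst_colAlg G K _)

end Sanity

end

end Summit.QuantumFields.BalabanUV.T4Continuum.HistoryRPTowerColumnCubes
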